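import Literature.AlgebraicGeometry.ComplexMultiplication.FieldOfDegreeTwoDimSimpleFactors
import Literature.AlgebraicGeometry.Motives.AbelianVarietyImageCommSubalgebraAction
import Literature.RingTheory.ZeroDimensional.FaithfulModuleDegreeBound
import HarnessLib

/-!
# A commutative semisimple subalgebra of `End⁰_k(X)` of degree `2 dim X` splits `X` into factors each carrying a
# number FIELD of degree `2 dim` — Shimura's «`(A, ι)` of type `(𝔖)`» reduced to the case of a field

G. Shimura, *Abelian Varieties with Complex Multiplication and Modular Functions* (1998), §5.1 Proposition 1 (p. 36): a
commutative semisimple subalgebra `𝔖 ⊆ End_Q(A)` has `[𝔖 : Q] ≤ 2 dim A`; in the extremal case `[𝔖 : Q] = 2 dim A`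
(«of CM-type», Milne 1999 §2 p. 54) one writes `𝔖 = K₁ × ⋯ × K_t` (product of fields), splits `A ∼ A₁ × ⋯ × A_t` by the
idempotents of `𝔖` (D. Mumford, *Abelian Varieties* §19, proof of Cor. 2 of Thm. 1, p. 174; Lange–Rodríguez 2022 Thm.
2.9.1), and gets `K_j ⊆ End_Q(A_j)` with `[K_j : Q] = 2 dim A_j` — the reduction of the semisimple case to Propositions
3–6 for a FIELD.  [Liu2021] App. D §D.4 (l. 5626) reaches this situation through multiplicity one: the Hecke algebra cut
on `H¹_B(A_K, ℚ)[π̲^∞]` is commutative semisimple of full degree, not a field in general.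

THIS FILE (theorems only) proves the splitting over ANY subfield `k ⊆ ℂ` (`[Algebra k ℂ]`) for the `k`-ENDOMORPHISM
algebra: given a commutative reduced `ℚ`-subalgebra `R ⊆ End⁰_k(X)` with `dim_ℚ R = 2 dim X`, there are orthogonal
quasi-idempotent endomorphisms `u_i ∈ End_k(X)` (`u_i u_j = 0` for `i ≠ j`, `Σ u_i = N`, `u_i² = N u_i`, lifted from the
primitive idempotents of `R ≅ ∏_𝔪 R/𝔪`, ★ `IsArtinianRing.equivPi`), so that `X ∼ ⨁_i Im u_i` (★
`isIsogenous_biproduct_image_of_orthogonal_of_sum_eq`) and EVERY factor `Im u_i` has positive dimension and carries a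
NUMBER FIELD `L_i → End⁰_k(Im u_i)` of degree EXACTLY `2 dim (Im u_i)`:
* the rational image action ★ `AbelianVariety.exists_ringHom_endAlgebra_image_of_comm_of_quasiIdempotent` gives
  `R → End⁰_k(Im u_i)` killing the maximal ideal `𝔪_i`, hence `R/𝔪_i → End⁰_k(Im u_i)` (re-typed as a number field by ★
  `FieldOnPowers.exists_numberField_ringHom_of_isField`);
* degrees: `[R/𝔪_i : ℚ] ≤ 2 dim (Im u_i)` (★ `finrank_dvd_two_mul_dim_of_ringHom_over`), `Σ_i [R/𝔪_i : ℚ] = dim_ℚ R =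
  2 dim X = 2 Σ_i dim (Im u_i)` (★ `dim_eq_sum_dim_image_of_orthogonal_of_sum_eq`), so every inequality is an equality.

* **`exists_orthogonal_quasiIdempotents_numberField_of_comm_isReduced`** — the splitting with the fields;
* **`exists_orthogonal_quasiIdempotents_isSimple_factor_of_comm_isReduced`** — composed with ★
  `exists_isSimple_factor_numberField_ringHom_bijective`: every factor `Im u_i ∼ ⨁ B_i` with `B_i` SIMPLE over `k` and
  `End⁰_k(B_i)` a number field of degree `2 dim B_i` (bijectively).

What is NOT here: CM-ness of the fields (positivity of a `k`-rational Rosati involution).  No definition, no named fact,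
no instance, no `sorry`.

DICTIONARY LINE (cell `hodgecm-mathlib`, crux `HLiu418` = stmt-HodgeConjecture-24832, d6 card S2′ road (6-i) step (4)):
`X := image u` the Hecke-isotypic quotient of `Alb X_K` over the CM field, `R :=` a maximal commutative subalgebra of the
Hecke image (full degree by multiplicity one, the `d_K > 1` entry point); the factors `Im u_i → ⨁ B_i → B_i` are the
quotients fed to ★ `Sec42Data.exists_heckeCharacter_towerRep_eq_inv_smul_of_ringHom′` with `(M, i, hdim) := (End⁰_k(B_i),
id, 2 dim B_i)`.  The file moves no book (HC_CM is proved only modulo the 7 printed citations until rung 0 closes).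

## References
* [Shimura1998] G. Shimura, *Abelian Varieties with Complex Multiplication and Modular Functions*, Princeton (1998),
  §5.1 Proposition 1 (p. 36), Propositions 3 and 4 (p. 37), Proposition 6 (p. 39).
* [MumfordAV1970] D. Mumford, *Abelian Varieties* (1970), §19 Thm. 1 (p. 173) and proof of Cor. 2 (p. 174).
* [Milne1999] J. S. Milne, *Lefschetz motives and the Tate conjecture*, Compositio Math. 117 (1999), §2 p. 54.
* [Liu2021] Y. Liu, *Fourier–Jacobi cycles and arithmetic relative trace formula*, Camb. J. Math. 9 (2021), App. D §D.4
  (FJcycle.tex l. 5626–5627).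
-/

noncomputable section

namespace Literature.AlgebraicGeometry.ComplexMultiplication

open CategoryTheory CategoryTheory.Limits NumberField
open Literature.AlgebraicGeometry.Motives Literature.RingTheory.ZeroDimensional

variable {k : Type} [Field k] [Algebra k ℂ] {X : AbelianVariety k}

/-- `dim_ℚ R = Σ_𝔪 [R/𝔪 : ℚ]` for a reduced finite-dimensional commutative `ℚ`-algebra (`R ≅ ∏_𝔪 R/𝔪`,
Mathlib `IsArtinianRing.equivPi`, read `ℚ`-linearly). [folklore] -/
private theorem sum_finrank_quotient_maximalSpectrum (R : Type) [CommRing R] [Algebra ℚ R] [Module.Finite ℚ R]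
    [IsReduced R] [Fintype (MaximalSpectrum R)] :
    ∑ m : MaximalSpectrum R, Module.finrank ℚ (R ⧸ m.asIdeal) = Module.finrank ℚ R := by
  haveI : IsArtinianRing R := IsArtinianRing.of_finite ℚ R
  let E : R ≃ₗ[ℚ] (∀ m : MaximalSpectrum R, R ⧸ m.asIdeal) :=
    (IsArtinianRing.equivPi R).toAddEquiv.toLinearEquiv fun c x =>
      map_rat_smul (IsArtinianRing.equivPi R).toAddEquiv.toAddMonoidHom c x
  rw [E.finrank_eq, Module.finrank_pi_fintype ℚ]

/-- **Splitting a commutative semisimple `R ⊆ End⁰_k(X)` of degree `2 dim X` into fields of full degree on factors.**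
For `X` over `k ⊆ ℂ` and a commutative reduced `ℚ`-subalgebra `R ⊆ End⁰_k(X)` with `dim_ℚ R = 2 dim X` there are a
finite index type `ι`, `N ≠ 0` and endomorphisms `u_i` of `X` with `u_i ≫ u_j = 0` (`i ≠ j`), `Σ u_i = N • 𝟙`,
`u_i ≫ u_i = N • u_i`, such that each `Im u_i` has positive dimension and carries a number field
`L_i →+* End⁰_k(Im u_i)` with `[L_i : ℚ] = 2 dim (Im u_i)`.  (Hence `X ∼ ⨁_i Im u_i` by ★
`isIsogenous_biproduct_image_of_orthogonal_of_sum_eq`.)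
[cite: Shimura1998, §5.1 Proposition 1 (p. 36), Propositions 3 and 4 (p. 37)] [cite: MumfordAV1970, §19 proof of Cor. 2 of Thm. 1 (p. 174)]
[cite: Milne1999, §2 p. 54] -/
theorem exists_orthogonal_quasiIdempotents_numberField_of_comm_isReduced (R : Subalgebra ℚ X.endAlgebra)
    (hcomm : ∀ x ∈ R, ∀ y ∈ R, x * y = y * x) [IsReduced R] (hdeg : Module.finrank ℚ R = 2 * X.dim) :
    ∃ (ι : Type) (_ : Fintype ι) (N : ℕ) (u : ι → (X ⟶ X)), N ≠ 0 ∧ (∀ i j, i ≠ j → u i ≫ u j = 0) ∧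
      ∑ i, u i = N • 𝟙 X ∧ (∀ i, u i ≫ u i = N • u i) ∧ (∀ i, AbelianVariety.endAlgebra.of X (u i) ∈ R) ∧
      ∀ i, 0 < (AbelianVariety.image (u i)).dim ∧
        ∃ (L : Type) (_ : Field L) (_ : NumberField L) (_ : L →+* (AbelianVariety.image (u i)).endAlgebra),
          Module.finrank ℚ L = 2 * (AbelianVariety.image (u i)).dim := by
  classical
  have hinj : Function.Injective (AbelianVariety.endAlgebra.of X) :=
    AbelianVariety.endAlgebra.of_injective_of_isIsogeny_zsmul_id (AbelianVariety.isIsogeny_zsmul_id_holds X)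
  -- `R` is a commutative reduced artinian ring: `R ≅ ∏_𝔪 R/𝔪`
  letI : CommRing R := { (inferInstance : Ring R) with mul_comm := fun x y => Subtype.ext (hcomm x x.2 y y.2) }
  haveI : Module.Finite ℚ R := AbelianVariety.endAlgebra.moduleFinite_subalgebra R
  haveI : IsArtinianRing R := IsArtinianRing.of_finite ℚ R
  haveI : Fintype (MaximalSpectrum R) := Fintype.ofFinite _
  -- the primitive idempotents `e_𝔪` and integral lifts `u_𝔪` with a common denominator `N`
  let e : MaximalSpectrum R → R := fun m => (IsArtinianRing.equivPi R).symm (Pi.single m 1)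
  have he_ne : ∀ m, e m ≠ 0 := fun m => equivPi_symm_single_ne_zero m
  have he_mul : ∀ m, e m * e m = e m := fun m => equivPi_symm_single_mul_self m
  have he_orth : ∀ m m', m ≠ m' → e m * e m' = 0 := fun m m' h => equivPi_symm_single_mul_of_ne h
  have he_sum : ∑ m, e m = 1 := by
    have h1 : (∑ x : MaximalSpectrum R, (Pi.single x 1 : ∀ m : MaximalSpectrum R, R ⧸ m.asIdeal)) = 1 := by
      simpa using Finset.univ_sum_single (1 : ∀ m : MaximalSpectrum R, R ⧸ m.asIdeal)
    change ∑ m, (IsArtinianRing.equivPi R).symm (Pi.single m 1) = 1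
    rw [← map_sum, h1, map_one]
  have he_sumE : (∑ m, (e m : X.endAlgebra)) = 1 := by
    have := congrArg Subtype.val he_sum
    simpa [AddSubmonoidClass.coe_finsetSum] using this
  have he_ann : ∀ (m : MaximalSpectrum R), ∀ x ∈ m.asIdeal, x * e m = 0 := fun m x hx =>
    mul_equivPi_symm_single_eq_zero m hx
  choose M F hM hMF using fun m => AbelianVariety.endAlgebra.exists_eq_algebraMap_mul_of ((e m : R) : X.endAlgebra)
  have hofF : ∀ m, AbelianVariety.endAlgebra.of X (F m) = (M m : ℚ) • (e m : X.endAlgebra) := fun m => by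
    have hMq : (M m : ℚ) ≠ 0 := Nat.cast_ne_zero.2 (hM m)
    rw [hMF m, Algebra.smul_def, ← mul_assoc, ← map_mul, mul_inv_cancel₀ hMq, map_one, one_mul]
  let N : ℕ := ∏ m, M m
  have hN : N ≠ 0 := Finset.prod_ne_zero_iff.2 fun m _ => hM m
  have hNq : (N : ℚ) ≠ 0 := Nat.cast_ne_zero.2 hN
  have hMN : ∀ m, M m ∣ N := fun m => Finset.dvd_prod_of_mem M (Finset.mem_univ m)
  -- integral lifts `u_𝔪` of `N e_𝔪` (elements of `End X`)
  obtain ⟨u, hofu⟩ : ∃ u : MaximalSpectrum R → End X, ∀ m, AbelianVariety.endAlgebra.of X (u m) = (N : ℚ) • (e m : X.endAlgebra) :=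
    ⟨fun m => (N / M m) • F m, fun m => by
      rw [map_nsmul, hofF, ← Nat.cast_smul_eq_nsmul ℚ, smul_smul, ← Nat.cast_mul, Nat.div_mul_cancel (hMN m)]⟩
  have huR : ∀ m, AbelianVariety.endAlgebra.of X (u m) ∈ R := fun m => by
    rw [hofu]; exact R.smul_mem (e m).2 _
  -- orthogonality, sum and quasi-idempotency in `End X`, read through the injective `End X → End⁰ X`
  have horthE : ∀ m m', m ≠ m' → u m' * u m = 0 := fun m m' h => hinj (by
    rw [map_mul, hofu, hofu, smul_mul_assoc, mul_smul_comm, ← MulMemClass.coe_mul, he_orth m' m (Ne.symm h),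
      ZeroMemClass.coe_zero, smul_zero, smul_zero, map_zero])
  have hsumE : ∑ m, u m = (N : End X) := hinj (by
    rw [map_sum, map_natCast]
    simp_rw [hofu]
    rw [← Finset.smul_sum, he_sumE, Algebra.smul_def, mul_one, map_natCast])
  have hselfE : ∀ m, u m * u m = N • u m := fun m => hinj (by
    rw [map_mul, map_nsmul, hofu, smul_mul_assoc, mul_smul_comm, ← MulMemClass.coe_mul, he_mul,
      ← Nat.cast_smul_eq_nsmul ℚ N])
  -- the same in `X ⟶ X`
  have horth : ∀ m m', m ≠ m' → (u m : X ⟶ X) ≫ u m' = 0 := fun m m' h => by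
    rw [← End.mul_def]; exact horthE m m' h
  have hsum : ∑ m, (u m : X ⟶ X) = N • 𝟙 X := by
    rw [← Nat.smul_one_eq_cast] at hsumE; exact hsumE
  have hself : ∀ m, (u m : X ⟶ X) ≫ u m = N • u m := fun m => by
    rw [← End.mul_def]; exact hselfE m
  have hdimsum : X.dim = ∑ m, (AbelianVariety.image (u m : X ⟶ X)).dim :=
    AbelianVariety.dim_eq_sum_dim_image_of_orthogonal_of_sum_eq hN horth hsum
  -- on each factor: the number field `R/𝔪 → End⁰_k(Im u_𝔪)` with `[R/𝔪 : ℚ] ≤ 2 dim (Im u_𝔪)`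
  have hpos : ∀ m, 0 < (AbelianVariety.image (u m : X ⟶ X)).dim := fun m => by
    refine AbelianVariety.dim_image_pos _ fun h0 => he_ne m (Subtype.ext ?_)
    have h1 : (N : ℚ) • (e m : X.endAlgebra) = 0 := by
      rw [← hofu]
      have : u m = 0 := h0
      rw [this, map_zero]
    rw [ZeroMemClass.coe_zero]
    exact (smul_eq_zero.1 h1).resolve_left hNq
  have per : ∀ m : MaximalSpectrum R, ∃ (L : Type) (_ : Field L) (_ : NumberField L)
      (_ : L →+* (AbelianVariety.image (u m : X ⟶ X)).endAlgebra),
      Module.finrank ℚ L = Module.finrank ℚ (R ⧸ m.asIdeal) ∧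
        Module.finrank ℚ L ≤ 2 * (AbelianVariety.image (u m : X ⟶ X)).dim := fun m => by
    haveI := m.isMaximal
    letI : Field (R ⧸ m.asIdeal) := Ideal.Quotient.field m.asIdeal
    haveI : Nontrivial (AbelianVariety.image (u m : X ⟶ X)).endAlgebra :=
      nontrivial_endAlgebra_of_dim_pos_of_algebra (hpos m)
    obtain ⟨ρ, -, -, hρ0⟩ := AbelianVariety.exists_ringHom_endAlgebra_image_of_comm_of_quasiIdempotent R hcomm
      (huR m) hN (hself m)
    -- `ρ` kills `𝔪`: `x ∈ 𝔪 ⇒ x e_𝔪 = 0 ⇒ x · of(u_𝔪) = N • (x e_𝔪) = 0`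
    have hker : ∀ x ∈ m.asIdeal, ρ x = 0 := fun x hx => hρ0 x (by
      rw [hofu, mul_smul_comm, ← MulMemClass.coe_mul, he_ann m x hx, ZeroMemClass.coe_zero, smul_zero])
    let j : R ⧸ m.asIdeal →+* (AbelianVariety.image (u m : X ⟶ X)).endAlgebra := Ideal.Quotient.lift m.asIdeal ρ hker
    -- re-type the image of the field `R/𝔪` as a number field
    let ja : R ⧸ m.asIdeal →ₐ[ℚ] (AbelianVariety.image (u m : X ⟶ X)).endAlgebra := j.toRatAlgHom
    have hja : Function.Injective ja := j.injective
    have hfield : IsField ja.range :=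
      MulEquiv.isField (B := R ⧸ m.asIdeal) (Field.toIsField _) (AlgEquiv.ofInjective ja hja).symm.toMulEquiv
    have hfr : Module.finrank ℚ ja.range = Module.finrank ℚ (R ⧸ m.asIdeal) :=
      (AlgEquiv.ofInjective ja hja).toLinearEquiv.finrank_eq.symm
    have hqpos : 0 < Module.finrank ℚ (R ⧸ m.asIdeal) := Module.finrank_pos
    obtain ⟨L, _, _, φ, hφdeg, -⟩ :=
      FieldOnPowers.exists_numberField_ringHom_of_isField ja.range hfield (by rw [hfr]; exact hqpos)
    refine ⟨L, inferInstance, inferInstance, φ, by rw [hφdeg, hfr], ?_⟩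
    have hdvd := finrank_dvd_two_mul_dim_of_ringHom_over φ
    exact Nat.le_of_dvd (by have := hpos m; omega) hdvd
  choose L iF iN φ hLdeg hLle using per
  -- the degree count: `Σ [R/𝔪 : ℚ] = dim_ℚ R = 2 dim X = Σ 2 dim (Im u_𝔪)`, termwise `≤`, hence termwise `=`
  have hsumR : ∑ m : MaximalSpectrum R, Module.finrank ℚ (R ⧸ m.asIdeal) = Module.finrank ℚ R :=
    sum_finrank_quotient_maximalSpectrum R
  have heq : ∀ m, Module.finrank ℚ (L m) = 2 * (AbelianVariety.image (u m : X ⟶ X)).dim := by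
    have hle : ∀ m ∈ (Finset.univ : Finset (MaximalSpectrum R)),
        Module.finrank ℚ (L m) ≤ 2 * (AbelianVariety.image (u m : X ⟶ X)).dim := fun m _ => hLle m
    have hsums : ∑ m, Module.finrank ℚ (L m) = ∑ m, 2 * (AbelianVariety.image (u m : X ⟶ X)).dim := by
      rw [← Finset.mul_sum, ← hdimsum, ← hdeg, ← hsumR]
      exact Finset.sum_congr rfl fun m _ => hLdeg m
    exact fun m => (Finset.sum_eq_sum_iff_of_le hle).1 hsums m (Finset.mem_univ m)
  exact ⟨MaximalSpectrum R, inferInstance, N, u, hN, horth, hsum, hself, huR, fun m =>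
    ⟨hpos m, L m, iF m, iN m, φ m, heq m⟩⟩

/-- **… and on each factor the `k`-simple piece with its endomorphism number field** (composition with ★
`exists_isSimple_factor_numberField_ringHom_bijective`): under the same hypotheses, for every factor `Im u_i` there are
a `k`-SIMPLE `B_i`, `n_i > 0` with `Im u_i ∼ ⨁_{Fin n_i} B_i`, and a number field `M_i` with a BIJECTIVE
`M_i →+* End⁰_k(B_i)`, `[M_i : ℚ] = 2 dim B_i` — [Liu2021]'s «`B_0` has complex multiplications by `M_0`» for a
commutative semisimple (not necessarily simple) Hecke cut.
[cite: Shimura1998, §5.1 Propositions 3 and 4 (p. 37), Proposition 6 (p. 39)] [cite: Liu2021, App. D §D.4 (FJcycle.tex l. 5626–5627)] -/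
theorem exists_orthogonal_quasiIdempotents_isSimple_factor_of_comm_isReduced (R : Subalgebra ℚ X.endAlgebra)
    (hcomm : ∀ x ∈ R, ∀ y ∈ R, x * y = y * x) [IsReduced R] (hdeg : Module.finrank ℚ R = 2 * X.dim) :
    ∃ (ι : Type) (_ : Fintype ι) (N : ℕ) (u : ι → (X ⟶ X)), N ≠ 0 ∧ (∀ i j, i ≠ j → u i ≫ u j = 0) ∧
      ∑ i, u i = N • 𝟙 X ∧ (∀ i, AbelianVariety.endAlgebra.of X (u i) ∈ R) ∧
      ∀ i, ∃ (B : AbelianVariety k) (n : ℕ), 0 < n ∧ B.IsSimple ∧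
        (AbelianVariety.image (u i)).IsIsogenous (⨁ fun _ : Fin n => B) ∧
        ∃ (M₀ : Type) (_ : Field M₀) (_ : NumberField M₀) (j : M₀ →+* B.endAlgebra),
          Function.Bijective j ∧ Module.finrank ℚ M₀ = 2 * B.dim := by
  obtain ⟨ι, _, N, u, hN, horth, hsum, -, huR, hfac⟩ :=
    exists_orthogonal_quasiIdempotents_numberField_of_comm_isReduced R hcomm hdeg
  refine ⟨ι, inferInstance, N, u, hN, horth, hsum, huR, fun i => ?_⟩
  obtain ⟨hpos, L, _, _, φ, hL⟩ := hfac i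
  exact exists_isSimple_factor_numberField_ringHom_bijective φ hL hpos

end Literature.AlgebraicGeometry.ComplexMultiplication

end
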